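import Summits.ABC.ABC.Theorems.TwistAmplificationSharpModerateLawUnitPlaneFlat6Defs
import Summits.ABC.ABC.Theorems.TwistAmplificationSharpModerateLawPlanarityFactorisationUniformBad

/-!
# Crux `TwistAmplification.SharpModerateLaw` (stmt-ABC-1975), line `unit-plane-conic-two-torsion`:
stub `stub_planarityFactorisationUniform` — the UNIFORM PLANARITY FACTORISATION

RUNNING LOG (worker C′, for the lead).
* Design: the landed architecture of `stub_planarityFactorisation` (`shapeIndex/shapeOf/shapeSet`,
  `datum_factorisation`) is kept verbatim; exactly the four `F`-dependent ingredients of `leverConst F` are replaced,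
  each with a uniform bound, in two helper files landed first:
  `…PlanarityFactorisationUniformReps.lean` (p123178: Minkowski representatives `minRep c`, `N ≤ √|Disc F|`, via
  `ringEquivInt F` and `ClassGroup.mk0_eq_mk0_iff`, no class-group isomorphism; `coIdeal`; `#unitReps F ≤ 8` from
  `torsionOrder_eq_two_of_odd_finrank` and `rank ≤ 2`) and `…PlanarityFactorisationUniformBad.lean` (≤ 3 primes over a
  rational prime by the norm count `p^{#} ≤ N((p)) = p³`; square-free bad ideals `badSqfree F`, `≤ 8^{ω(M)}`;
  `classesOver 𝔞 = {c : c² = [𝔞]}` of size `≤ twoTorsionCard F`; the count constant `8·3^{ω(T)}·8^{ω(6A)} ≤ C(δ)(AT)^δ`).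
* Constants: `C₀(δ) = max (C(δ)) 216`; norms `|Nλ| ≤ N𝔞'·r⁴ ≤ (M³T)·|D|² = 216|a|³|D|⁵·T`; `r = N(minRep c) ≤ √|D|`.
* `Λ 0 = ∅` (the statement's count bound vanishes at `T = 0`; `T = sqfreeKernel ≥ 1` on data).
* Remaining goals: none once this file lands.

For an irreducible maximal `F`, `O = R(F)`, `M = 6|a||Disc F|`, every coprime datum `(u, v)` with `F(u, v) ≠ 0`
factors as `r²(a u + v ω) = λβ²` with `λ ∈ Λ T`, `S ∣ |Nβ|`, `1 ≤ r ≤ √|Disc F|`, where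
`#Λ T ≤ 8·3^{ω(T)}·8^{ω(M)}·|Cl(O)[2]| ≤ C(δ)·(|a||Disc F|T)^δ·|Cl(O)[2]|` and `|Nλ| ≤ 216|a|³|Disc F|⁵·T` on `Λ T`:
* the shape index is `(w, 𝔡, c, η)` with `w ∈ ∏_{q ∣ T} shapeRoots F q` (`≤ 3^{ω(T)}`), `𝔡 ∈ badSqfree F`
  (`≤ 8^{ω(M)}`), `c ∈ classesOver (𝔞'(w)·𝔡)` (`≤ |Cl[2]|`), `η ∈ unitReps F` (`≤ 8`); the shape is
  `gen(𝔞'(w)·𝔡·𝔰_c²)·η` with `𝔰_c = coIdeal (minRep c)`, `(r_c) = minRep c · 𝔰_c`, `r_c = N(minRep c) ≤ √|Disc F|`;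
* the datum: `(a u + v ω) = 𝔞'𝔟²` (`span_planeElt_eq`), `𝔞' = 𝔞'(w)·𝔞'_bad` with `𝔞'_bad ∈ badSqfree F`
  (`oddBadIdeal_mem_badSqfree`), `c = [𝔟]⁻¹ ∈ classesOver 𝔞'` (`inv_mk0_mem_classesOver`), `𝔟·minRep c = (β₀)`,
  `(r²(au + vω)) = (𝔞'𝔰_c²)(β₀²)`, generator and unit normalised modulo squares exactly as in the landed proof;
  `|Nλ| = N𝔞'·r_c⁴ ≤ M³T·|Disc F|²`.
-/

noncomputable section

-- the mandated summit namespace `Summit.ABC.ABC` (summit = problem) trips the duplicate-namespace linter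
set_option linter.dupNamespace false

namespace Summit.ABC.ABC.Theorems.SharpModerateLaw.UnitPlane

open Literature.NumberTheory.CubicFields
open RingOfForm (omega theta RatAlgebra)
open scoped nonZeroDivisors

/-! ## 1. The uniform shape sets -/

section Shapes

variable {F : BinaryCubic ℤ} [hF : Fact F.IsIrreducible] [hM : Fact (RingOfForm.IsMaximal F)]

variable (F) in
omit hM in
/-- The type of uniform shape indices at level `T`: `((w, 𝔡), c), η`. -/
abbrev UIndex (T : ℕ) : Type :=
  (Σ _ : ((q : ℕ) → q ∈ T.primeFactors → ℕ) × Ideal (RingOfForm F), ClassGroup (RingOfForm F)) × (RingOfForm F)ˣ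

variable (F) in
/-- The UNIFORM index set of the shapes at level `T`: residue vectors × square-free bad ideals, over each such pair
`(w, 𝔡)` the classes `c` with `c² = [𝔞'(w)·𝔡]`, times the unit representatives. -/
def ushapeIndex (T : ℕ) : Finset (UIndex F T) :=
  (((T.primeFactors.pi fun q => shapeRoots F q) ×ˢ badSqfree F).sigma fun wd => classesOver (goodIdeal T wd.1 * wd.2)) ×ˢ
    unitReps F

/-- The shape `gen(𝔞'(w)·𝔡·𝔰_c²)·η` of a uniform index, `𝔰_c = coIdeal (minRep c)`. -/
def ushapeOf (T : ℕ) (i : UIndex F T) : RingOfForm F :=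
  gen (goodIdeal T i.1.1.1 * i.1.1.2 * coIdeal (minRep i.1.2) ^ 2) * (i.2 : RingOfForm F)

variable (F) in
/-- The uniform norm bound `216·|a|³·|Disc F|⁵` (`= M³·|Disc F|²`). -/
def unormBound : ℕ := 216 * F.a.natAbs ^ 3 * F.disc.natAbs ^ 5

omit hF hM in
/-- `M³·|Disc F|² = 216|a|³|Disc F|⁵`. -/
theorem badModulus_pow_mul_sq : badModulus F ^ 3 * F.disc.natAbs ^ 2 = unormBound F := by
  unfold badModulus unormBound; ring

open scoped Classical in
variable (F) in
/-- **The uniform shape set `Λ T`**: all shapes of uniform indices at level `T ≥ 1` of norm `≤ 216|a|³|Disc F|⁵·T`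
(and `Λ 0 = ∅`). -/
def ushapeSet (T : ℕ) : Finset (RingOfForm F) :=
  if T = 0 then ∅ else ((ushapeIndex F T).image (ushapeOf T)).filter fun l => (Algebra.norm ℤ l).natAbs ≤ unormBound F * T

/-- `Λ 0 = ∅`. -/
theorem ushapeSet_zero : ushapeSet F 0 = ∅ := by
  rw [ushapeSet, if_pos rfl]

/-- **`#Λ T ≤ 8·3^{ω(T)}·8^{ω(M)}·|Cl(O)[2]|`** (three shape roots per prime, `8^{ω(M)}` square-free bad ideals, a
`Cl[2]`-coset of classes, `8` units modulo squares). -/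
theorem card_ushapeSet_le (T : ℕ) :
    (ushapeSet F T).card ≤ 8 * 3 ^ T.primeFactors.card * 8 ^ (badModulus F).primeFactors.card * twoTorsionCard F := by
  classical
  unfold ushapeSet
  split_ifs with hT
  · exact Nat.zero_le _
  have hpi : (T.primeFactors.pi fun q => shapeRoots F q).card ≤ 3 ^ T.primeFactors.card := by
    rw [Finset.card_pi]
    exact Finset.prod_le_pow_card _ _ 3 fun q hq => card_shapeRoots_le_three F q (Nat.prime_of_mem_primeFactors hq)
  have hsigma : (((T.primeFactors.pi fun q => shapeRoots F q) ×ˢ badSqfree F).sigma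
      fun wd => classesOver (goodIdeal T wd.1 * wd.2)).card ≤
        3 ^ T.primeFactors.card * 8 ^ (badModulus F).primeFactors.card * twoTorsionCard F := by
    rw [Finset.card_sigma]
    calc ∑ wd ∈ (T.primeFactors.pi fun q => shapeRoots F q) ×ˢ badSqfree F, (classesOver (goodIdeal T wd.1 * wd.2)).card
        ≤ ∑ _wd ∈ (T.primeFactors.pi fun q => shapeRoots F q) ×ˢ badSqfree F, twoTorsionCard F :=
          Finset.sum_le_sum fun wd _ => card_classesOver_le _
      _ = (T.primeFactors.pi fun q => shapeRoots F q).card * (badSqfree F).card * twoTorsionCard F := by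
          rw [Finset.sum_const, smul_eq_mul, Finset.card_product]
      _ ≤ 3 ^ T.primeFactors.card * 8 ^ (badModulus F).primeFactors.card * twoTorsionCard F :=
          Nat.mul_le_mul_right _ (Nat.mul_le_mul hpi card_badSqfree_le)
  calc (((ushapeIndex F T).image (ushapeOf T)).filter fun l => (Algebra.norm ℤ l).natAbs ≤ unormBound F * T).card
      ≤ ((ushapeIndex F T).image (ushapeOf T)).card := Finset.card_filter_le _ _
    _ ≤ (ushapeIndex F T).card := Finset.card_image_le
    _ = (((T.primeFactors.pi fun q => shapeRoots F q) ×ˢ badSqfree F).sigma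
          fun wd => classesOver (goodIdeal T wd.1 * wd.2)).card * (unitReps F).card := by
        rw [ushapeIndex, Finset.card_product]
    _ ≤ (3 ^ T.primeFactors.card * 8 ^ (badModulus F).primeFactors.card * twoTorsionCard F) * 8 :=
        Nat.mul_le_mul hsigma card_unitReps_le
    _ = 8 * 3 ^ T.primeFactors.card * 8 ^ (badModulus F).primeFactors.card * twoTorsionCard F := by ring

/-- Norms on `Λ T` are `≤ 216|a|³|Disc F|⁵·T` (by construction). -/
theorem norm_le_of_mem_ushapeSet {T : ℕ} {l : RingOfForm F} (hl : l ∈ ushapeSet F T) :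
    (Algebra.norm ℤ l).natAbs ≤ unormBound F * T := by
  classical
  unfold ushapeSet at hl
  split_ifs at hl with hT
  · simp at hl
  · exact (Finset.mem_filter.mp hl).2

/-! ## 2. The datum: `r²(a u + v ω) = λ β²` with uniform `λ`, `r` -/

/-- **The uniform factorisation of a datum.** For coprime `(u, v)` with `F(u, v) ≠ 0` there are `λ ∈ Λ T`, `β` and
`1 ≤ r ≤ √|Disc F|` with `r²(au + vω) = λβ²` and `S ∣ |Nβ|` (`T`, `S` the square-free kernel and square part of `m♭`). -/
theorem udatum_factorisation {u v : ℤ} (huv : IsCoprime u v) (h0 : F.eval u v ≠ 0) :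
    ∃ l ∈ ushapeSet F (sqfreeKernel (coprimePart (badModulus F) (F.eval u v).natAbs)),
      ∃ β : RingOfForm F, ∃ r : ℕ, 1 ≤ r ∧ (r : ℝ) ≤ Real.sqrt (F.disc.natAbs : ℝ) ∧
        ((r : RingOfForm F) ^ 2) * planeElt F u v = l * β ^ 2 ∧
        sqPart (coprimePart (badModulus F) (F.eval u v).natAbs) ∣ (Algebra.norm ℤ β).natAbs := by
  classical
  set mf := coprimePart (badModulus F) (F.eval u v).natAbs with hmf
  set T := sqfreeKernel mf with hT
  set x := planeElt F u v with hx
  set 𝔟 := sqIdeal F u v with h𝔟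
  set 𝔞 := oddIdeal F u v with h𝔞
  have h𝔟0 : 𝔟 ∈ (Ideal (RingOfForm F))⁰ := mem_nonZeroDivisors_of_ne_zero (by rw [Ideal.zero_eq_bot]; exact sqIdeal_ne_bot h0)
  -- the class `c = [𝔟]⁻¹`, its Minkowski representative `𝔯`, `r = N𝔯`, `(r) = 𝔯 𝔰`
  set c : ClassGroup (RingOfForm F) := (ClassGroup.mk0 ⟨𝔟, h𝔟0⟩)⁻¹ with hc
  set 𝔯 : Ideal (RingOfForm F) := (minRep c : Ideal (RingOfForm F)) with h𝔯
  set 𝔰 := coIdeal (minRep c) with h𝔰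
  set r := Ideal.absNorm 𝔯 with hr
  -- `𝔟 𝔯 = (β₀)` is principal
  have hprinc : (𝔟 * 𝔯).IsPrincipal := by
    have h1 : ClassGroup.mk0 (⟨𝔟, h𝔟0⟩ * minRep c) = 1 := by rw [map_mul, mk0_minRep, hc, mul_inv_cancel]
    exact (ClassGroup.mk0_eq_one_iff (Submonoid.mul_mem _ h𝔟0 (minRep c).2)).mp h1
  set β₀ := gen (𝔟 * 𝔯) with hβ₀
  have hβ₀span : Ideal.span {β₀} = 𝔟 * 𝔯 := span_gen hprinc
  have hβ₀0 : β₀ ≠ 0 := by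
    intro h
    have h𝔟𝔯 : 𝔟 * 𝔯 = ⊥ := by rw [← hβ₀span, h, Ideal.span_singleton_eq_bot]
    rcases Ideal.mul_eq_bot.mp h𝔟𝔯 with h' | h'
    · exact sqIdeal_ne_bot h0 h'
    · rw [← Ideal.zero_eq_bot] at h'
      exact nonZeroDivisors.ne_zero (minRep c).2 h'
  -- `(r² x) = 𝔞 𝔰² · (β₀²)`
  set J := 𝔞 * 𝔰 ^ 2 with hJ
  have hspan : Ideal.span {(r : RingOfForm F) ^ 2 * x} = J * Ideal.span {β₀ ^ 2} := by
    calc Ideal.span {(r : RingOfForm F) ^ 2 * x} = Ideal.span {(r : RingOfForm F)} ^ 2 * Ideal.span {x} := by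
          rw [← Ideal.span_singleton_mul_span_singleton, Ideal.span_singleton_pow]
      _ = (𝔯 * 𝔰) ^ 2 * (𝔞 * 𝔟 ^ 2) := by rw [hr, h𝔯, span_absNorm_eq_mul_coIdeal, hx, span_planeElt_eq h0]
      _ = 𝔞 * 𝔰 ^ 2 * (𝔟 * 𝔯) ^ 2 := by ring
      _ = J * Ideal.span {β₀ ^ 2} := by rw [← hβ₀span, Ideal.span_singleton_pow]
  -- so `β₀² ∣ r² x`, `r² x = β₀² l₀` with `(l₀) = J`
  obtain ⟨l₀, hl₀⟩ : β₀ ^ 2 ∣ (r : RingOfForm F) ^ 2 * x := by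
    rw [← Ideal.mem_span_singleton]
    have : (r : RingOfForm F) ^ 2 * x ∈ Ideal.span {(r : RingOfForm F) ^ 2 * x} := Ideal.mem_span_singleton_self _
    rw [hspan] at this
    exact Ideal.mul_le_left this
  have hJspan : Ideal.span {l₀} = J := by
    have h2 : Ideal.span {β₀ ^ 2} * Ideal.span {l₀} = Ideal.span {β₀ ^ 2} * J := by
      rw [Ideal.span_singleton_mul_span_singleton, ← hl₀, hspan, mul_comm]
    exact mul_left_cancel₀ (by rw [Ideal.zero_eq_bot, Ne, Ideal.span_singleton_eq_bot]; exact pow_ne_zero 2 hβ₀0) h2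
  have hJprinc : J.IsPrincipal := by rw [← hJspan]; exact ⟨l₀, rfl⟩
  -- `l₀ = gen J · ε`, `ε = η ε₁²`
  obtain ⟨ε, hε⟩ : Associated (gen J) l₀ := by
    rw [← Ideal.span_singleton_eq_span_singleton, span_gen hJprinc, hJspan]
  obtain ⟨η, hη, ε₁, hε₁⟩ := exists_unitReps_mul_sq ε
  -- the bad part, the residue vector and the class of the datum
  have hbad : oddBadIdeal F u v ∈ badSqfree F := oddBadIdeal_mem_badSqfree h0
  set w : (q : ℕ) → q ∈ T.primeFactors → ℕ := fun q _ => residueAt F u v q with hw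
  have hwpi : w ∈ T.primeFactors.pi fun q => shapeRoots F q := by
    rw [Finset.mem_pi]
    intro q hq
    obtain ⟨hqp, hqa, hqF⟩ := flatPrime_spec h0 (mem_primeFactors_sqfreeKernel.mp hq).1
    exact residueAt_mem_shapeRoots hqp hqa huv hqF
  have hgood : goodIdeal T w * oddBadIdeal F u v = 𝔞 := by
    rw [h𝔞, oddIdeal_eq huv h0, goodIdeal, ← hT]
    congr 1
    exact Finset.prod_attach T.primeFactors fun q => primeIdealAt F q (residueAt F u v q)
  have hclass : c ∈ classesOver (goodIdeal T w * oddBadIdeal F u v) := by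
    rw [hgood]
    exact inv_mk0_mem_classesOver h𝔟0 (planeElt_ne_zero h0) (span_planeElt_eq h0)
  -- norms
  have hr1 : 1 ≤ r := Ideal.absNorm_pos_of_nonZeroDivisors (minRep c)
  have hrD : (r : ℝ) ≤ Real.sqrt (F.disc.natAbs : ℝ) := absNorm_minRep_le_sqrt c
  have hr2 : r ^ 2 ≤ F.disc.natAbs := absNorm_minRep_sq_le c
  have hNJ : Ideal.absNorm J ≤ unormBound F * T := by
    rw [hJ, map_mul, map_pow, h𝔰, absNorm_coIdeal, ← hr, ← badModulus_pow_mul_sq]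
    calc Ideal.absNorm 𝔞 * (r ^ 2) ^ 2 ≤ (badModulus F ^ 3 * T) * F.disc.natAbs ^ 2 :=
          Nat.mul_le_mul (absNorm_oddIdeal_le huv h0) (Nat.pow_le_pow_left hr2 2)
      _ = badModulus F ^ 3 * F.disc.natAbs ^ 2 * T := by ring
  have hT0 : T ≠ 0 := sqfreeKernel_ne_zero mf
  -- the shape `l = gen J · η` and `β = β₀ ε₁`
  refine ⟨gen J * (η : RingOfForm F), ?_, β₀ * (ε₁ : RingOfForm F), r, hr1, hrD, ?_, ?_⟩
  · -- membership in `Λ T`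
    rw [ushapeSet, if_neg hT0, Finset.mem_filter]
    refine ⟨Finset.mem_image.mpr ⟨((⟨(w, oddBadIdeal F u v), c⟩ : Σ _, ClassGroup (RingOfForm F)), η), ?_, ?_⟩, ?_⟩
    · simp only [ushapeIndex, Finset.mem_product, Finset.mem_sigma]
      exact ⟨⟨⟨hwpi, hbad⟩, hclass⟩, hη⟩
    · simp only [ushapeOf, hJ, ← hgood, h𝔰]
    · rw [map_mul, Int.natAbs_mul, natAbs_norm_unit, mul_one, natAbs_norm_gen hJprinc]
      exact hNJ
  · -- the identity `r² x = (gen J η) (β₀ ε₁)²`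
    rw [hl₀, ← hε, hε₁]
    push_cast
    ring
  · -- `S ∣ |N β| = N𝔟 · r`
    rw [map_mul, Int.natAbs_mul, natAbs_norm_unit, mul_one, ← Ideal.absNorm_span_singleton, hβ₀span, map_mul]
    exact (sqPart_dvd_absNorm_sqIdeal huv h0).mul_right _

end Shapes

/-! ## 3. The uniform lever -/

/-- **UNIFORM PLANARITY FACTORISATION** (registered stub `stub_planarityFactorisationUniform` of stmt-ABC-1975, the
uniform form of the line's lever): for every `δ > 0` there is `C₀ = max (C(δ)) 216` such that for EVERY irreducible
maximal `F`, with `Λ = ushapeSet F`, every coprime datum factors as `r²(au + vω) = λβ²`, `λ ∈ Λ T`, `S ∣ |Nβ|`,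
`1 ≤ r ≤ C₀√|Disc F|`, where `#Λ T ≤ C₀·(|a|·|Disc F|·T)^δ·|Cl(R(F))[2]|` and `|Nλ| ≤ C₀·|a|³|Disc F|⁵·T` on `Λ T`. -/
theorem stub_planarityFactorisationUniform : PlanarityFactorisationUniform := by
  intro δ hδ
  obtain ⟨C, hC1, hC⟩ := exists_shapeCount_const hδ
  refine ⟨max C 216, lt_max_of_lt_left (by linarith), fun F hirr hmax => ?_⟩
  haveI : Fact F.IsIrreducible := ⟨hirr⟩
  haveI : Fact (RingOfForm.IsMaximal F) := ⟨hmax⟩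
  have hCmax : C ≤ max C 216 := le_max_left _ _
  have h216 : (216 : ℝ) ≤ max C 216 := le_max_right _ _
  refine ⟨ushapeSet F, fun T => ?_, fun T l hl => ?_, fun u v huv h0 => ?_⟩
  · -- the shape count
    rcases Nat.eq_zero_or_pos T with rfl | hT
    · rw [ushapeSet_zero, Finset.card_empty, Nat.cast_zero]
      exact mul_nonneg (mul_nonneg (by linarith) (Real.rpow_nonneg (by positivity) δ)) (Nat.cast_nonneg _)
    · set A : ℕ := F.a.natAbs * F.disc.natAbs with hA_def
      have hA : A ≠ 0 := mul_ne_zero (Int.natAbs_ne_zero.mpr hirr.1)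
        (Int.natAbs_ne_zero.mpr (BinaryCubic.disc_ne_zero_of_isIrreducible hirr))
      have hM6 : badModulus F = 6 * A := by rw [hA_def, badModulus, mul_assoc]
      have h1 := card_ushapeSet_le (F := F) T
      rw [hM6] at h1
      have h1' : ((ushapeSet F T).card : ℝ) ≤
          (8 : ℝ) * 3 ^ T.primeFactors.card * 8 ^ (6 * A).primeFactors.card * twoTorsionCard F := by
        exact_mod_cast h1
      have h2 := hC A T hA hT.ne'
      have hAcast : ((F.a.natAbs : ℝ) * F.disc.natAbs * T) = (A : ℝ) * T := by rw [hA_def, Nat.cast_mul]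
      rw [hAcast]
      have ht : (0 : ℝ) ≤ twoTorsionCard F := Nat.cast_nonneg _
      have hpow : (0 : ℝ) ≤ ((A : ℝ) * T) ^ δ := Real.rpow_nonneg (by positivity) δ
      calc ((ushapeSet F T).card : ℝ)
          ≤ (8 : ℝ) * 3 ^ T.primeFactors.card * 8 ^ (6 * A).primeFactors.card * twoTorsionCard F := h1'
        _ ≤ C * ((A : ℝ) * T) ^ δ * twoTorsionCard F := mul_le_mul_of_nonneg_right h2 ht
        _ ≤ max C 216 * ((A : ℝ) * T) ^ δ * twoTorsionCard F :=
            mul_le_mul_of_nonneg_right (mul_le_mul_of_nonneg_right hCmax hpow) ht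
  · -- the norm bound
    have h := norm_le_of_mem_ushapeSet hl
    have h' : ((Algebra.norm ℤ l).natAbs : ℝ) ≤ (216 : ℝ) * (F.a.natAbs : ℝ) ^ 3 * (F.disc.natAbs : ℝ) ^ 5 * T := by
      have : ((Algebra.norm ℤ l).natAbs : ℝ) ≤ ((unormBound F * T : ℕ) : ℝ) := by exact_mod_cast h
      simpa [unormBound] using this
    refine h'.trans ?_
    have hnn : (0 : ℝ) ≤ (F.a.natAbs : ℝ) ^ 3 * (F.disc.natAbs : ℝ) ^ 5 * T := by positivity
    calc (216 : ℝ) * (F.a.natAbs : ℝ) ^ 3 * (F.disc.natAbs : ℝ) ^ 5 * T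
        = 216 * ((F.a.natAbs : ℝ) ^ 3 * (F.disc.natAbs : ℝ) ^ 5 * T) := by ring
      _ ≤ max C 216 * ((F.a.natAbs : ℝ) ^ 3 * (F.disc.natAbs : ℝ) ^ 5 * T) := mul_le_mul_of_nonneg_right h216 hnn
      _ = max C 216 * (F.a.natAbs : ℝ) ^ 3 * (F.disc.natAbs : ℝ) ^ 5 * T := by ring
  · -- the datum
    obtain ⟨l, hl, β, r, hr1, hr, hid, hS⟩ := udatum_factorisation huv h0
    refine ⟨l, hl, β, r, hr1, hr.trans ?_, hid, hS⟩
    exact le_mul_of_one_le_left (Real.sqrt_nonneg _) (le_trans (by norm_num) h216)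

end Summit.ABC.ABC.Theorems.SharpModerateLaw.UnitPlane

end
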